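import Mathlib.Combinatorics.SimpleGraph.Finite
import Mathlib.Data.Sym.Sym2
import Mathlib.LinearAlgebra.Eigenspace.Basic
import Literature.MathematicalPhysics.QuantumLattice.FinDimSpectrum
import Literature.MathematicalPhysics.QuantumLattice.SpinOperators
import Literature.MathematicalPhysics.QuantumLattice.SpinSystem
import Literature.Probability.LatticeModels.LatticeGraph
import HarnessLib

-- provenance: harness21/H21/H21/Prelude/QLatticeAQFT/HeisenbergModel.lean @ 7095ce4 (interim HEAD d8f2665); M5 mechanical rewrite
/-!
# Heisenberg-type Hamiltonians on finite graphs (trunk QLatticeAQFT, item Q4)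

Quantum spin-`S` (`S = n/2`, local dimension `q = n + 1`) Heisenberg models on a finite set of
sites `Λ` with couplings along the edges of a `SimpleGraph Λ`:

* `spinBond n α x y = ½ (S^α_x S^α_y + S^α_y S^α_x)` and the exchange operator
  `spinDot n x y = 𝐒_x · 𝐒_y = Σ_α spinBond n α x y`, both symmetric in `(x, y)` *by construction*
  (`spinBond_comm`, `spinDot_comm`), so that they descend to unordered pairs via `Sym2.lift`;
* `heisenbergHamiltonian n G J = J Σ_{{x,y} ∈ E(G)} 𝐒_x · 𝐒_y` (antiferromagnet iff `0 < J`),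
  the inhomogeneous version `heisenbergWith n G J` (`J : Sym2 Λ → ℝ`), the XXZ model
  `xxzHamiltonian n G J Δ`, the bilinear-biquadratic model `biquadraticHamiltonian n G J K` and the
  AKLT Hamiltonian `akltHamiltonian G` (spin `1`, `K = J/3 = 1/3`);
* chains: the periodic ring `heisenbergRing L n = Σ_{i ∈ ℤ/L} 𝐒_i · 𝐒_{i+1}` and the open chain
  `heisenbergOpenChain L n` on `Fin L`;
* magnetisation sectors `spinZSector n M = ker (S^z_tot - M)`, the sector energy
  `lowestEnergyInSector n H M`, and the Marshall sign `marshallSign A σ = (-1)^{Σ_{x∈A} σ_x}`.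

API: `spinBond_isHermitian`, `spinDot_isHermitian`, `heisenbergHamiltonian_isHermitian` (proved),
`commute_heisenberg_totalSpin`, `commute_heisenberg_globalRotation` (`SU(2)` invariance),
`heisenbergRing_eq_heisenbergHamiltonian_torusGraph` (the ring is the Heisenberg model on the
`d = 1` torus graph of `Literature.Probability.LatticeModels.torusGraph`, `3 ≤ L`).

## Sources

* H. Tasaki, *Physics and Mathematics of Quantum Many-Body Systems* (Springer, 2020), §2.4
  (Heisenberg antiferromagnet, Marshall–Lieb–Mattis, eqs. (2.4.1), (2.4.5)), §2.5
  (ferromagnet, `SU(2)` invariance, eqs. (2.5.1)–(2.5.2)), §7.1 (AKLT model, eq. (7.1.1)).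
* I. Affleck, T. Kennedy, E. H. Lieb, H. Tasaki, *Valence bond ground states in isotropic quantum
  antiferromagnets*, Comm. Math. Phys. 115 (1988) 477–528, eq. (1.2).
* W. Marshall, Proc. Roy. Soc. A 232 (1955) 48; E. Lieb, D. Mattis, J. Math. Phys. 3 (1962) 749.

## Mathlib / H21 status and design choices

* Mathlib has no quantum spin Hamiltonians (grep `heisenberg`/`Heisenberg`: only unrelated hits).
  Used from Mathlib: `SimpleGraph.edgeFinset` (needs `[Fintype Λ] [DecidableRel G.Adj]`),
  `Sym2.lift`, `Module.End.eigenspace`, `Matrix.toLin'`, `Matrix.IsHermitian`.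
  Used from H21: `siteSpin`, `totalSpin`, `globalRotation`, `reindexOp`, `Op`, `TensorIndex`
  (`SpinSystem`), `Matrix.minEnergyOn` (`FinDimSpectrum`), `StatMech.torusGraph` (`LatticeGraph`).
* The bond operator is symmetrised, `½ (S_x S_y + S_y S_x)`, so that symmetry in `(x, y)` is a
  one-line real proof and `Sym2.lift` needs no `sorry`; for `x ≠ y` the two site spins commute
  (`siteSpin_commute_of_ne`) and this is the usual `S^α_x S^α_y`.
* `heisenbergRing L n` lives on `ZMod L` (needs `[NeZero L]` for finiteness). For `L = 2` the sum
  `Σ_i 𝐒_i · 𝐒_{i+1}` counts the single bond twice, and for `L = 1` it is the on-site Casimir;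
  target statements quantify over `2 ≤ L` (or `3 ≤ L`) following the texts.
* `heisenbergOpenChain L n` lives on `Fin L` and is written as a double sum with the constraint
  `i + 1 = j` (no `Fin` arithmetic, no natural subtraction).
* The spin index `n` is an explicit argument throughout (it cannot be inferred from `Op Λ (n+1)`
  robustly).
-/

noncomputable section

open Matrix Complex

namespace Literature.MathematicalPhysics.QuantumLattice

section QLattice

variable {Λ : Type*} [Fintype Λ] [DecidableEq Λ] (n : ℕ)

/-! ### Bond operators -/

/-- The symmetrised `α`-component bond operator `½ (S^α_x S^α_y + S^α_y S^α_x)` of spin `n/2`;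
for `x ≠ y` this equals `S^α_x S^α_y`. Tasaki (2020) §2.4, eq. (2.4.1). [cite: Tasaki2020] -/
def spinBond (α : Fin 3) (x y : Λ) : Op Λ (n + 1) :=
  (1 / 2 : ℂ) • (siteSpin n x α * siteSpin n y α + siteSpin n y α * siteSpin n x α)

/-- The bond operator is symmetric in the two sites (by construction). Tasaki (2020) §2.4. [cite: Tasaki2020] -/
theorem spinBond_comm (α : Fin 3) (x y : Λ) : spinBond n α y x = spinBond n α x y := by
  simp [spinBond, add_comm]

/-- The Heisenberg exchange operator `𝐒_x · 𝐒_y = Σ_α S^α_x S^α_y` (symmetrised form).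
Tasaki (2020) §2.4, eq. (2.4.1). [cite: Tasaki2020] -/
def spinDot (x y : Λ) : Op Λ (n + 1) :=
  ∑ α : Fin 3, spinBond n α x y

/-- `𝐒_x · 𝐒_y = 𝐒_y · 𝐒_x`. Tasaki (2020) §2.4. [cite: Tasaki2020] -/
theorem spinDot_comm (x y : Λ) : spinDot n y x = spinDot n x y := by
  simp [spinDot, spinBond_comm]

/-- The bond operators are Hermitian. Tasaki (2020) §2.4. [cite: Tasaki2020] -/
theorem spinBond_isHermitian (α : Fin 3) (x y : Λ) : (spinBond n α x y).IsHermitian := by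
  have hx := (siteSpin_isHermitian (Λ := Λ) n x α).eq
  have hy := (siteSpin_isHermitian (Λ := Λ) n y α).eq
  unfold spinBond
  refine IsHermitian.smul ?_ ?_
  · rw [IsHermitian, conjTranspose_add, conjTranspose_mul, conjTranspose_mul, hx, hy]
    exact add_comm _ _
  · rw [isSelfAdjoint_iff, Complex.star_def, map_div₀, map_one, map_ofNat]

/-- `𝐒_x · 𝐒_y` is Hermitian. Tasaki (2020) §2.4. [cite: Tasaki2020] -/
theorem spinDot_isHermitian (x y : Λ) : (spinDot n x y).IsHermitian := by
  unfold spinDot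
  rw [IsHermitian, conjTranspose_sum]
  exact Finset.sum_congr rfl fun α _ => (spinBond_isHermitian n α x y).eq

/-- `𝐒_x · 𝐒_y` as a function on unordered pairs `{x, y} : Sym2 Λ`. Tasaki (2020) §2.4. [cite: Tasaki2020] -/
def spinDotSym : Sym2 Λ → Op Λ (n + 1) :=
  Sym2.lift ⟨spinDot n, fun x y => (spinDot_comm n y x)⟩

/-- Unfolding `spinDotSym` on a pair. [folklore] -/
@[simp]
theorem spinDotSym_mk (x y : Λ) : spinDotSym n s(x, y) = spinDot n x y := rfl

/-! ### Hamiltonians on graphs -/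

section Graph

variable (G : SimpleGraph Λ) [DecidableRel G.Adj]

/-- The **Heisenberg Hamiltonian** `H = J Σ_{{x,y} ∈ E(G)} 𝐒_x · 𝐒_y` of spin `n/2` on the finite
graph `G`; antiferromagnetic iff `0 < J`, ferromagnetic iff `J < 0`.
Tasaki (2020) §2.4, eq. (2.4.1) and §2.5, eq. (2.5.1). [cite: Tasaki2020] -/
def heisenbergHamiltonian (J : ℝ) : Op Λ (n + 1) :=
  (J : ℂ) • ∑ e ∈ G.edgeFinset, spinDotSym n e

/-- The inhomogeneous Heisenberg Hamiltonian `H = Σ_{{x,y} ∈ E(G)} J_{xy} 𝐒_x · 𝐒_y` with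
bond-dependent couplings `J : Sym2 Λ → ℝ`. Tasaki (2020) §2.4, eq. (2.4.1). [cite: Tasaki2020] -/
def heisenbergWith (J : Sym2 Λ → ℝ) : Op Λ (n + 1) :=
  ∑ e ∈ G.edgeFinset, (J e : ℂ) • spinDotSym n e

/-- The **XXZ Hamiltonian** `H = J Σ_{{x,y} ∈ E(G)} (Sˣ_x Sˣ_y + Sʸ_x Sʸ_y + Δ Sᶻ_x Sᶻ_y)` with
anisotropy `Δ`. Tasaki (2020) §2.4 (remarks after eq. (2.4.1)); §4.1. [cite: Tasaki2020] -/
def xxzHamiltonian (J Δ : ℝ) : Op Λ (n + 1) :=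
  (J : ℂ) • ∑ e ∈ G.edgeFinset,
    Sym2.lift ⟨fun x y => spinBond n 0 x y + spinBond n 1 x y + (Δ : ℂ) • spinBond n 2 x y,
      fun x y => by simp only [spinBond_comm]⟩ e

/-- The **bilinear-biquadratic Hamiltonian**
`H = Σ_{{x,y} ∈ E(G)} (J 𝐒_x · 𝐒_y + K (𝐒_x · 𝐒_y)²)`. AKLT, CMP 115 (1988), eq. (1.2);
Tasaki (2020) §7.1. [cite: Tasaki2020] -/
def biquadraticHamiltonian (J K : ℝ) : Op Λ (n + 1) :=
  ∑ e ∈ G.edgeFinset,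
    Sym2.lift ⟨fun x y => (J : ℂ) • spinDot n x y + (K : ℂ) • (spinDot n x y * spinDot n x y),
      fun x y => by simp only [spinDot_comm]⟩ e

end Graph

/-- The **AKLT Hamiltonian** (spin `1`, `n = 2`): `H = Σ_{{x,y} ∈ E(G)} (𝐒_x · 𝐒_y + ⅓ (𝐒_x · 𝐒_y)²)`,
i.e. `biquadraticHamiltonian 2 G 1 (1/3)`; each term is `2 P₂(x,y) - 2/3` with `P₂` the projection
onto total bond spin `2`. AKLT, CMP 115 (1988), eq. (1.2); Tasaki (2020) §7.1, eq. (7.1.1). [cite: Tasaki2020] -/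
def akltHamiltonian (G : SimpleGraph Λ) [DecidableRel G.Adj] : Op Λ 3 :=
  biquadraticHamiltonian 2 G 1 (1 / 3)

/-! ### Chains -/

/-- The periodic antiferromagnetic Heisenberg ring `H = Σ_{i ∈ ℤ/Lℤ} 𝐒_i · 𝐒_{i+1}` of spin
`n/2` on `L` sites. **Degenerate cases:** for `L = 2` the single bond `{0, 1}` is counted twice,
for `L = 1` the sum is the on-site Casimir `𝐒_0 · 𝐒_0`; statements assume `2 ≤ L` or `3 ≤ L`
following the texts. Tasaki (2020) §2.4; Lieb–Schultz–Mattis (1961). [cite: Tasaki2020] -/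
def heisenbergRing (L : ℕ) [NeZero L] (n : ℕ) : Op (ZMod L) (n + 1) :=
  ∑ i : ZMod L, spinDot n i (i + 1)

/-- The open antiferromagnetic Heisenberg chain `H = Σ_{i=0}^{L-2} 𝐒_i · 𝐒_{i+1}` of spin `n/2`
on the sites `Fin L` (free boundary conditions), written as a constrained double sum.
Tasaki (2020) §2.4; AKLT, CMP 115 (1988), §2. [cite: Tasaki2020] -/
def heisenbergOpenChain (L n : ℕ) : Op (Fin L) (n + 1) :=
  ∑ i : Fin L, ∑ j : Fin L, if i.val + 1 = j.val then spinDot n i j else 0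

/-! ### Magnetisation sectors and the Marshall sign -/

/-- The magnetisation sector `𝓗_M = ker (Sᶻ_tot - M)`, the eigenspace of the total spin-`z`
operator (acting on `TensorIndex Λ (n+1) → ℂ` by `Matrix.toLin'`) for the eigenvalue `M`.
It is `⊥` unless `M ∈ {-|Λ| n/2, …, |Λ| n/2}`. Tasaki (2020) §2.4, eq. (2.4.5); Lieb–Mattis (1962). [cite: Tasaki2020] -/
def spinZSector (M : ℝ) : Submodule ℂ (TensorIndex Λ (n + 1) → ℂ) :=
  Module.End.eigenspace (Matrix.toLin' (totalSpin (Λ := Λ) n 2)) (M : ℂ)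

/-- The lowest energy `E(M)` of the Hamiltonian `H` in the magnetisation sector `Sᶻ_tot = M`
(`Matrix.minEnergyOn`; junk value `0` on an empty sector). Lieb–Mattis (1962), Theorem 2;
Tasaki (2020) §2.4, Theorem 2.3. [cite: LiebMattis1962] -/
def lowestEnergyInSector (H : Op Λ (n + 1)) (M : ℝ) : ℝ :=
  H.minEnergyOn (spinZSector n M)

/-- The **Marshall sign** `(-1)^{Σ_{x ∈ A} σ_x}` of a basis configuration `σ` relative to a
sublattice `A` (with our basis convention `σ_x = k ↔ m = n/2 - k`, the exponent is
`Σ_{x∈A} (S - m_x)`). Marshall (1955); Tasaki (2020) §2.4, proof of Theorem 2.3. [cite: Marshall1955] -/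
def marshallSign {q : ℕ} (A : Finset Λ) (σ : TensorIndex Λ q) : ℂ :=
  (-1) ^ (∑ x ∈ A, (σ x : ℕ))

/-! ### API -/

section API

variable (G : SimpleGraph Λ) [DecidableRel G.Adj]

/-- Each edge term `𝐒_x · 𝐒_y` is Hermitian. Tasaki (2020) §2.4. [cite: Tasaki2020] -/
theorem spinDotSym_isHermitian (e : Sym2 Λ) : (spinDotSym n e).IsHermitian := by
  induction e using Sym2.ind with
  | h x y => exact spinDot_isHermitian n x y

/-- The Heisenberg Hamiltonian is Hermitian. Tasaki (2020) §2.4. [cite: Tasaki2020] -/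
theorem heisenbergHamiltonian_isHermitian (J : ℝ) :
    (heisenbergHamiltonian n G J).IsHermitian := by
  unfold heisenbergHamiltonian
  refine IsHermitian.smul ?_ ?_
  · rw [IsHermitian, conjTranspose_sum]
    exact Finset.sum_congr rfl fun e _ => (spinDotSym_isHermitian n e).eq
  · rw [isSelfAdjoint_iff, Complex.star_def, conj_ofReal]

/-- **`SU(2)` invariance (infinitesimal form).** The Heisenberg Hamiltonian commutes with every
component of the total spin, `[H, S^α_tot] = 0`. Tasaki (2020) §2.5, eq. (2.5.2). [cite: Tasaki2020] -/
def commute_heisenberg_totalSpin : Prop :=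
  ∀ (J : ℝ) (α : Fin 3),
    Commute (heisenbergHamiltonian n G J) (totalSpin n α)

/-- **`SU(2)` invariance (global form).** The Heisenberg Hamiltonian commutes with the global
rotations `U(θ) = ⨂_x exp(-i θ·𝐒_x)`. Tasaki (2020) §2.5, eq. (2.5.2) and §2.2, eq. (2.2.12). [cite: Tasaki2020] -/
def commute_heisenberg_globalRotation : Prop :=
  ∀ (J : ℝ) (θ : Fin 3 → ℝ),
    Commute (heisenbergHamiltonian n G J) (globalRotation n θ)

/-- For `3 ≤ L` the Heisenberg ring on `ℤ/Lℤ` is the (`J = 1`) Heisenberg Hamiltonian on the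
one-dimensional torus graph `Literature.StatMech.torusGraph 1 L` (vertex type `Fin 1 → ZMod L`),
transported along `Fin 1 → ZMod L ≃ ZMod L`. (For `L = 2` the torus graph has one edge while the
ring counts it twice.) Tasaki (2020) §2.4; Friedli–Velenik (2017) §3.1. [cite: Tasaki2020] -/
def heisenbergRing_eq_heisenbergHamiltonian_torusGraph : Prop :=
  ∀ (L : ℕ) [NeZero L] (hL : 3 ≤ L),
    heisenbergRing L n =
      reindexOp (Equiv.funUnique (Fin 1) (ZMod L))
        (heisenbergHamiltonian n (Literature.Probability.LatticeModels.torusGraph 1 L) 1)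

end API

end QLattice

end Literature.MathematicalPhysics.QuantumLattice
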